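import Literature.Probability.LatticeModels.DelaunayGraph
import Literature.Analysis.FunctionSpaces.PointConfigKernel
import Literature.Analysis.FunctionSpaces.PoissonMeckePrelims
import Mathlib.Topology.MetricSpace.ProperSpace
import Mathlib.Analysis.SpecificLimits.Basic
import HarnessLib

/-!
# Measurability of the Delaunay graph and of nearest sites for the count σ-algebra

Topic `Probability/LatticeModels`; theorem-only companion of `DelaunayGraph.lean` and
`PoissonDelaunayIsing.lean` (no definitions, no named facts). For the count σ-algebra on locally
finite configurations `PointConfig E` (generated by `ω ↦ N_ω(s)`, `PoissonPointProcess.lean`) of a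
proper second countable metric space `E` we prove:

* `isDelaunayPair_iff_approx` — the empty circumscribed ball rule `IsDelaunayPair ω p q`
  (`∃` centre `c` equidistant from `p`, `q` with no site strictly closer; Boissonnat–Yvinec 1998,
  Thm 17.3.4) is equivalent to a COUNTABLE condition: approximate centres from a dense sequence,
  in a bounded region, with defects `≤ 1/(k+1)` for every `k` (compactness of closed balls passes
  to an exact centre). Hence the Delaunay adjacency relation is jointly measurable in
  (configuration, site, site) (`measurableSet_isDelaunayPair`: the defect conditions are void
  events of measurably parametrised sets, `PointConfig.measurableSet_count_preimage_eq_zero`).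
* `measurableSet_isNearest`, `measurable_count_isNearest_inter`,
  `measurableSet_existsUnique_isNearest`, `measurableSet_exists_isNearest_mem` — the relation
  "`q` is a site of `ω` nearest to `y`", the number of nearest sites in a measurable set, and the
  events "the nearest site is unique" / "some nearest site lies in `s`" are measurable (the
  Euclidean analogue of `measurableSet_isChordalNearest` of `ChordalNearest.lean`).
* `finite_neighborSet_iff`, `measurableSet_locallyFinite_delaunay` — a site has finitely many
  Delaunay neighbours iff its neighbours lie in a bounded set, so the event "the Delaunay graph of
  `ω` is locally finite" (the non-junk branch of `finVolExpect` in `PoissonDelaunayIsing.lean`) is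
  measurable.

These are the measurability inputs for the quenched/annealed Poisson–Delaunay Ising correlators
(Last–Penrose 2017, Ch. 2 and Prop. 4.3 for the underlying Campbell measurability).

## References

* J.-D. Boissonnat, M. Yvinec, *Algorithmic Geometry*, CUP 1998, Thm 17.3.4. [`BoissonnatYvinec1998`]
* G. Last, M. Penrose, *Lectures on the Poisson Process*, CUP 2017, §2.1–2.2, Prop. 4.3. [`LastPenrose2017`]
-/

noncomputable section

open MeasureTheory Set Metric Filter TopologicalSpace
open scoped Topology ENNReal

namespace Literature.Probability.LatticeModels

open Literature.Analysis.FunctionSpaces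

/-! ### A countable characterisation of the empty circumscribed ball rule -/

section Approx

variable {E : Type*} [MetricSpace E] [ProperSpace E]

/-- **Countable form of the empty-ball rule.** In a proper separable metric space with dense
sequence `d = denseSeq E`, `IsDelaunayPair ω p q` holds iff for some `N`, for every `k` there is
an approximate centre `d i` with `dist (d i) p ≤ N`, `|dist p (d i) - dist q (d i)| ≤ 1/(k+1)` and
`dist p (d i) ≤ dist z (d i) + 1/(k+1)` for all sites `z ∈ ω` (exact centres are approximated by
the dense sequence; conversely a subsequence of approximate centres converges in the compact ball
`closedBall p N` to an exact centre). [folklore] -/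
theorem isDelaunayPair_iff_approx [SeparableSpace E] [Nonempty E] (ω : Set E) (p q : E) :
    IsDelaunayPair ω p q ↔ ∃ N : ℕ, ∀ k : ℕ, ∃ i : ℕ,
      dist (denseSeq E i) p ≤ N ∧
      |dist p (denseSeq E i) - dist q (denseSeq E i)| ≤ 1 / ((k : ℝ) + 1) ∧
      ∀ z ∈ ω, dist p (denseSeq E i) ≤ dist z (denseSeq E i) + 1 / ((k : ℝ) + 1) := by
  set d := denseSeq E with hd
  have hdense : DenseRange d := denseRange_denseSeq E
  constructor
  · intro h
    obtain ⟨c, hpq, hc⟩ := isDelaunayPair_iff_exists_center.1 h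
    refine ⟨⌈dist c p⌉₊ + 1, fun k => ?_⟩
    have hk : (0 : ℝ) < (k : ℝ) + 1 := by positivity
    have hε : (0 : ℝ) < 1 / (2 * ((k : ℝ) + 1)) := by positivity
    obtain ⟨i, hi⟩ := hdense.exists_dist_lt c hε
    have hε1 : 1 / (2 * ((k : ℝ) + 1)) ≤ 1 := by
      rw [div_le_one (by positivity)]
      nlinarith [k.cast_nonneg (α := ℝ)]
    have h2ε : 2 * dist c (d i) ≤ 1 / ((k : ℝ) + 1) := by
      calc 2 * dist c (d i) ≤ 2 * (1 / (2 * ((k : ℝ) + 1))) := by gcongr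
        _ = 1 / ((k : ℝ) + 1) := by field_simp
    refine ⟨i, ?_, ?_, fun z hz => ?_⟩
    · calc dist (d i) p ≤ dist (d i) c + dist c p := dist_triangle _ _ _
        _ ≤ 1 + ⌈dist c p⌉₊ := by
            rw [dist_comm (d i) c]
            exact add_le_add (hi.le.trans hε1) (Nat.le_ceil _)
        _ = ((⌈dist c p⌉₊ + 1 : ℕ) : ℝ) := by push_cast; ring
    · have h1 : |dist p (d i) - dist p c| ≤ dist (d i) c := by
        rw [dist_comm p (d i), dist_comm p c]; exact abs_dist_sub_le (d i) c p
      have h2 : |dist q (d i) - dist q c| ≤ dist (d i) c := by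
        rw [dist_comm q (d i), dist_comm q c]; exact abs_dist_sub_le (d i) c q
      rw [dist_comm (d i) c] at h1 h2
      rw [abs_le] at h1 h2 ⊢
      constructor <;> linarith [h1.1, h1.2, h2.1, h2.2]
    · have h1 : dist p (d i) ≤ dist p c + dist c (d i) := dist_triangle _ _ _
      have h2 : dist z c ≤ dist z (d i) + dist (d i) c := dist_triangle _ _ _
      have h3 := hc z hz
      rw [dist_comm (d i) c] at h2
      linarith
  · rintro ⟨N, hN⟩
    choose i hi using hN
    obtain ⟨c₀, -, φ, hφ, hlim⟩ := (isCompact_closedBall p (N : ℝ)).tendsto_subseq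
      (x := fun k => d (i k)) fun k => mem_closedBall.2 (hi k).1
    have hδ : Tendsto (fun k : ℕ => 1 / ((φ k : ℝ) + 1)) atTop (𝓝 0) :=
      tendsto_one_div_add_atTop_nhds_zero_nat.comp hφ.tendsto_atTop
    have hp : Tendsto (fun k => dist p (d (i (φ k)))) atTop (𝓝 (dist p c₀)) :=
      tendsto_const_nhds.dist hlim
    have hq : Tendsto (fun k => dist q (d (i (φ k)))) atTop (𝓝 (dist q c₀)) :=
      tendsto_const_nhds.dist hlim
    have heq : dist p c₀ = dist q c₀ := by
      have h0 : Tendsto (fun k => dist p (d (i (φ k))) - dist q (d (i (φ k)))) atTop (𝓝 0) :=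
        squeeze_zero_norm (fun k => by rw [Real.norm_eq_abs]; exact (hi (φ k)).2.1) hδ
      exact sub_eq_zero.1 (tendsto_nhds_unique (hp.sub hq) h0)
    refine isDelaunayPair_iff_exists_center.2 ⟨c₀, heq, fun z hz => ?_⟩
    have hz' : Tendsto (fun k => dist z (d (i (φ k))) + 1 / ((φ k : ℝ) + 1)) atTop
        (𝓝 (dist z c₀ + 0)) :=
      (tendsto_const_nhds.dist hlim).add hδ
    rw [add_zero] at hz'
    exact le_of_tendsto_of_tendsto' hp hz' fun k => (hi (φ k)).2.2 z hz

end Approx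

/-! ### Measurability of the Delaunay adjacency relation -/

section Measurability

variable {E : Type*} [MetricSpace E] [ProperSpace E] [SecondCountableTopology E]
  [MeasurableSpace E] [BorelSpace E]
  {α : Type*} [MeasurableSpace α] {g : α → PointConfig E}

/-- **The Delaunay adjacency relation is measurable**: for a measurable family of configurations
`g a` and measurable points `y₁ a`, `y₂ a`, the set of parameters `a` at which `y₁ a`, `y₂ a`
satisfy the empty circumscribed ball rule with respect to `g a` is measurable for the count
σ-algebra (countable form `isDelaunayPair_iff_approx`; the conditions "no site strictly closer
than … to the approximate centre" are void events of measurably parametrised sets,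
`PointConfig.measurableSet_count_preimage_eq_zero`). [folklore] -/
theorem measurableSet_isDelaunayPair {y₁ y₂ : α → E} (hg : Measurable g) (hy₁ : Measurable y₁)
    (hy₂ : Measurable y₂) : MeasurableSet {a | IsDelaunayPair (g a : Set E) (y₁ a) (y₂ a)} := by
  rcases isEmpty_or_nonempty α with hα | ⟨⟨a₀⟩⟩
  · rw [Set.eq_empty_of_isEmpty {a | IsDelaunayPair (g a : Set E) (y₁ a) (y₂ a)}]
    exact MeasurableSet.empty
  haveI : Nonempty E := ⟨y₁ a₀⟩
  set d := denseSeq E with hd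
  -- the parametrised "strictly closer" sets
  set t : ℕ → ℕ → Set (α × E) := fun i k =>
    {r | dist r.2 (d i) + 1 / ((k : ℝ) + 1) < dist (y₁ r.1) (d i)} with ht
  have htm : ∀ i k, MeasurableSet (t i k) := fun i k =>
    measurableSet_lt ((measurable_snd.dist measurable_const).add_const _)
      ((hy₁.comp measurable_fst).dist measurable_const)
  have key : {a | IsDelaunayPair (g a : Set E) (y₁ a) (y₂ a)} =
      ⋃ N : ℕ, ⋂ k : ℕ, ⋃ i : ℕ, ({a | dist (d i) (y₁ a) ≤ N} ∩
        {a | |dist (y₁ a) (d i) - dist (y₂ a) (d i)| ≤ 1 / ((k : ℝ) + 1)} ∩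
        {a | (g a).count (Prod.mk a ⁻¹' t i k) = 0}) := by
    ext a
    simp only [mem_setOf_eq, mem_iUnion, mem_iInter, mem_inter_iff]
    rw [isDelaunayPair_iff_approx]
    refine exists_congr fun N => forall_congr' fun k => exists_congr fun i => ?_
    rw [and_assoc]
    refine and_congr Iff.rfl (and_congr Iff.rfl ?_)
    rw [PointConfig.count, Set.encard_eq_zero, Set.eq_empty_iff_forall_notMem]
    simp only [mem_inter_iff, mem_preimage, ht, mem_setOf_eq, not_and, not_lt,
      PointConfig.mem_carrier]
    rfl
  rw [key]
  refine MeasurableSet.iUnion fun N => MeasurableSet.iInter fun k =>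
    MeasurableSet.iUnion fun i => MeasurableSet.inter (MeasurableSet.inter ?_ ?_) ?_
  · exact measurableSet_le (measurable_const.dist hy₁) measurable_const
  · exact measurableSet_le (continuous_abs.measurable.comp
      ((hy₁.dist measurable_const).sub (hy₂.dist measurable_const))) measurable_const
  · exact PointConfig.measurableSet_count_preimage_eq_zero (htm i k) hg

/-- Joint version: `{(ω, p, q) | IsDelaunayPair ω p q}` is measurable in
`PointConfig E × E × E`. [folklore] -/
theorem measurableSet_isDelaunayPair_prod :
    MeasurableSet {r : PointConfig E × E × E | IsDelaunayPair (r.1 : Set E) r.2.1 r.2.2} :=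
  measurableSet_isDelaunayPair measurable_fst (measurable_fst.comp measurable_snd)
    (measurable_snd.comp measurable_snd)

/-- The adjacency relation of the Delaunay GRAPH (`p ≠ q` and the empty-ball rule) is measurable
in (configuration, site, site). [folklore] -/
theorem measurableSet_ne_and_isDelaunayPair {y₁ y₂ : α → E} (hg : Measurable g)
    (hy₁ : Measurable y₁) (hy₂ : Measurable y₂) :
    MeasurableSet {a | y₁ a ≠ y₂ a ∧ IsDelaunayPair (g a : Set E) (y₁ a) (y₂ a)} :=
  (measurableSet_eq_fun hy₁ hy₂).compl.inter (measurableSet_isDelaunayPair hg hy₁ hy₂)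

/-! ### Nearest sites -/

/-- **The nearest-site relation is measurable**: for measurable families of configurations `g a`
and points `y a`, `z a`, the set of `a` at which `z a` is a site of `g a` nearest to `y a`
(`z a ∈ g a` and no site is strictly closer) is measurable — membership is measurable
(`PointConfig.measurableSet_mem_comp`) and "no site strictly closer" is a void event. [folklore] -/
theorem measurableSet_isNearest {y z : α → E} (hg : Measurable g) (hy : Measurable y)
    (hz : Measurable z) :
    MeasurableSet {a | z a ∈ g a ∧ ∀ q ∈ g a, dist (y a) (z a) ≤ dist (y a) q} := by
  have h1 : MeasurableSet {a | z a ∈ g a} := PointConfig.measurableSet_mem_comp hz hg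
  have ht : MeasurableSet {r : α × E | dist (y r.1) r.2 < dist (y r.1) (z r.1)} :=
    measurableSet_lt ((hy.comp measurable_fst).dist measurable_snd)
      ((hy.comp measurable_fst).dist (hz.comp measurable_fst))
  have h2 := PointConfig.measurableSet_count_preimage_eq_zero ht hg
  convert h1.inter h2 using 1
  ext a
  simp only [mem_setOf_eq, mem_inter_iff]
  refine and_congr Iff.rfl ?_
  rw [PointConfig.count, Set.encard_eq_zero, Set.eq_empty_iff_forall_notMem]
  simp only [mem_inter_iff, mem_preimage, mem_setOf_eq, not_and, not_lt, PointConfig.mem_carrier]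

/-- Joint version: `{((ω, y), q) | q is a site of ω nearest to y}` is measurable. [folklore] -/
theorem measurableSet_isNearest_prod :
    MeasurableSet {r : (PointConfig E × E) × E |
      r.2 ∈ r.1.1 ∧ ∀ q ∈ r.1.1, dist r.1.2 r.2 ≤ dist r.1.2 q} :=
  measurableSet_isNearest (measurable_fst.comp measurable_fst) (measurable_snd.comp measurable_fst)
    measurable_snd

omit [ProperSpace E] [SecondCountableTopology E] [MeasurableSpace E] [BorelSpace E] in
/-- The count of nearest sites in `s` is the cardinality of the set of nearest sites in `s`
(nearest sites are sites). [folklore] -/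
theorem count_isNearest_inter (ω : PointConfig E) (y : E) (s : Set E) :
    ω.count ({q | q ∈ ω ∧ ∀ q' ∈ ω, dist y q ≤ dist y q'} ∩ s) =
      ({q | q ∈ ω ∧ ∀ q' ∈ ω, dist y q ≤ dist y q'} ∩ s).encard := by
  rw [PointConfig.count]
  congr 1
  exact inter_eq_right.2 fun q hq => hq.1.1

omit [ProperSpace E] [SecondCountableTopology E] [MeasurableSpace E] [BorelSpace E] in
/-- The count of nearest sites is the cardinality of the set of nearest sites. [folklore] -/
theorem count_setOf_isNearest (ω : PointConfig E) (y : E) :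
    ω.count {q | q ∈ ω ∧ ∀ q' ∈ ω, dist y q ≤ dist y q'} =
      {q | q ∈ ω ∧ ∀ q' ∈ ω, dist y q ≤ dist y q'}.encard := by
  rw [PointConfig.count]
  congr 1
  exact inter_eq_right.2 fun q hq => hq.1

/-- **The number of nearest sites in a measurable set is measurable** (a parametrised count,
`PointConfig.measurable_toMeasure_preimage`). [folklore] -/
theorem measurable_count_isNearest_inter {y : α → E} (hg : Measurable g) (hy : Measurable y)
    {s : Set E} (hs : MeasurableSet s) :
    Measurable fun a =>
      (g a).count ({q | q ∈ g a ∧ ∀ q' ∈ g a, dist (y a) q ≤ dist (y a) q'} ∩ s) := by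
  set S : Set (α × E) :=
    {p | p.2 ∈ g p.1 ∧ ∀ q' ∈ g p.1, dist (y p.1) p.2 ≤ dist (y p.1) q'} ∩ Prod.snd ⁻¹' s with hS
  have hSm : MeasurableSet S :=
    (measurableSet_isNearest (hg.comp measurable_fst) (hy.comp measurable_fst) measurable_snd).inter
      (measurable_snd hs)
  have h1 : Measurable fun a => (g a).toMeasure (Prod.mk a ⁻¹' S) :=
    PointConfig.measurable_toMeasure_preimage hSm hg
  have h2 : ∀ a, (g a).toMeasure (Prod.mk a ⁻¹' S) =
      (((g a).count ({q | q ∈ g a ∧ ∀ q' ∈ g a, dist (y a) q ≤ dist (y a) q'} ∩ s) : ℕ∞) :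
        ℝ≥0∞) := fun a => by
    rw [PointConfig.toMeasure_apply _ (measurable_prodMk_left hSm)]
    rfl
  simp_rw [h2] at h1
  refine measurable_to_countable' fun n => ?_
  have : (fun a => (g a).count
      ({q | q ∈ g a ∧ ∀ q' ∈ g a, dist (y a) q ≤ dist (y a) q'} ∩ s)) ⁻¹' {n} =
      (fun a => (((g a).count
        ({q | q ∈ g a ∧ ∀ q' ∈ g a, dist (y a) q ≤ dist (y a) q'} ∩ s) : ℕ∞) : ℝ≥0∞)) ⁻¹'
        {(n : ℝ≥0∞)} := by
    ext a
    simp only [mem_preimage, mem_singleton_iff, ENat.toENNReal_inj]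
  rw [this]
  exact h1 (measurableSet_singleton _)

/-- **The event "the nearest site is unique" is measurable** (exactly one nearest site).
[folklore] -/
theorem measurableSet_existsUnique_isNearest {y : α → E} (hg : Measurable g) (hy : Measurable y) :
    MeasurableSet {a | ∃! q, q ∈ g a ∧ ∀ q' ∈ g a, dist (y a) q ≤ dist (y a) q'} := by
  have h := measurable_count_isNearest_inter hg hy MeasurableSet.univ (measurableSet_singleton 1)
  convert h using 1
  ext a
  simp only [mem_setOf_eq, mem_preimage, mem_singleton_iff, inter_univ, count_setOf_isNearest,
    Set.encard_eq_one]
  constructor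
  · rintro ⟨q, hq, huq⟩
    exact ⟨q, Set.eq_singleton_iff_unique_mem.2 ⟨hq, fun q' hq' => huq q' hq'⟩⟩
  · rintro ⟨q, hq⟩
    obtain ⟨hq1, hq2⟩ := Set.eq_singleton_iff_unique_mem.1 hq
    exact ⟨q, hq1, hq2⟩

/-- **The event "some nearest site lies in `s`" is measurable** for measurable `s`. [folklore] -/
theorem measurableSet_exists_isNearest_mem {y : α → E} (hg : Measurable g) (hy : Measurable y)
    {s : Set E} (hs : MeasurableSet s) :
    MeasurableSet {a | ∃ q ∈ s, q ∈ g a ∧ ∀ q' ∈ g a, dist (y a) q ≤ dist (y a) q'} := by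
  have h := (measurable_count_isNearest_inter hg hy hs (measurableSet_singleton 0)).compl
  convert h using 1
  ext a
  simp only [mem_setOf_eq, mem_compl_iff, mem_preimage, mem_singleton_iff, count_isNearest_inter,
    Set.encard_eq_zero, ← Ne.eq_def, ← nonempty_iff_ne_empty]
  constructor
  · rintro ⟨q, hqs, hq⟩
    exact ⟨q, hq, hqs⟩
  · rintro ⟨q, hq, hqs⟩
    exact ⟨q, hqs, hq⟩

/-! ### Local finiteness of the Delaunay graph is a measurable event -/

omit [SecondCountableTopology E] [MeasurableSpace E] [BorelSpace E] in
/-- A site of a locally finite configuration in a proper space has finitely many Delaunay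
neighbours iff its neighbours lie at bounded distance (finitely many sites in every ball).
[folklore] -/
theorem finite_neighborSet_iff (ω : PointConfig E) (v : (ω : Set E)) :
    ((delaunayGraph (ω : Set E)).neighborSet v).Finite ↔
      ∃ N : ℕ, ∀ q ∈ ω, ((v : E) ≠ q ∧ IsDelaunayPair (ω : Set E) v q) → dist (v : E) q ≤ N := by
  constructor
  · intro hfin
    have hfin' : ((fun w : (ω : Set E) => dist (v : E) w) ''
        ((delaunayGraph (ω : Set E)).neighborSet v)).Finite := hfin.image _
    obtain ⟨M, hM⟩ := hfin'.bddAbove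
    refine ⟨⌈M⌉₊, fun q hq hadj => ?_⟩
    have hw : (⟨q, hq⟩ : (ω : Set E)) ∈ (delaunayGraph (ω : Set E)).neighborSet v := by
      rw [SimpleGraph.mem_neighborSet, delaunayGraph_adj]
      exact ⟨fun h => hadj.1 (congrArg Subtype.val h), hadj.2⟩
    exact (hM (mem_image_of_mem _ hw)).trans (Nat.le_ceil M)
  · rintro ⟨N, hN⟩
    have hfin := ω.finite_inter_closedBall (v : E) N
    refine (hfin.preimage Subtype.val_injective.injOn).subset fun w hw => ?_
    rw [SimpleGraph.mem_neighborSet, delaunayGraph_adj] at hw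
    refine ⟨w.2, mem_closedBall.2 ?_⟩
    rw [dist_comm]
    exact hN w w.2 ⟨fun h => hw.1 (Subtype.ext h), hw.2⟩

/-- **"The Delaunay graph is locally finite" is a measurable event** for the count σ-algebra:
by `finite_neighborSet_iff` its complement is "some site has, for every `N`, a Delaunay
neighbour at distance `> N`", an iterated non-void event of measurably parametrised sets
(`measurableSet_isDelaunayPair`, `PointConfig.measurableSet_count_preimage_eq_zero`). This is the
non-junk branch of `finVolExpect` (`PoissonDelaunayIsing.lean`). [folklore] -/
theorem measurableSet_locallyFinite_delaunay :
    MeasurableSet {ω : PointConfig E | ∀ v, ((delaunayGraph (ω : Set E)).neighborSet v).Finite} := by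
  -- far Delaunay neighbours of the marked site, as a parametrised set
  set t : ℕ → Set ((PointConfig E × E) × E) := fun N =>
    {r | (r.1.2 ≠ r.2 ∧ IsDelaunayPair (r.1.1 : Set E) r.1.2 r.2) ∧ (N : ℝ) < dist r.1.2 r.2}
    with ht
  have htm : ∀ N, MeasurableSet (t N) := fun N =>
    (measurableSet_ne_and_isDelaunayPair (measurable_fst.comp measurable_fst)
      (measurable_snd.comp measurable_fst) measurable_snd).inter
      (measurableSet_lt measurable_const ((measurable_snd.comp measurable_fst).dist measurable_snd))
  have hB : ∀ N, MeasurableSet {r : PointConfig E × E | r.1.count (Prod.mk r ⁻¹' t N) = 0} :=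
    fun N => PointConfig.measurableSet_count_preimage_eq_zero (htm N) measurable_fst
  -- marked sites with neighbours at unbounded distances
  set T : Set (PointConfig E × E) :=
    ⋂ N : ℕ, {r : PointConfig E × E | r.1.count (Prod.mk r ⁻¹' t N) = 0}ᶜ with hT
  have hTm : MeasurableSet T := MeasurableSet.iInter fun N => (hB N).compl
  have hout := PointConfig.measurableSet_count_preimage_eq_zero hTm
    (measurable_id : Measurable fun ω : PointConfig E => ω)
  convert hout using 1
  ext ω
  simp only [mem_setOf_eq]
  rw [PointConfig.count, Set.encard_eq_zero, Set.eq_empty_iff_forall_notMem]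
  constructor
  · rintro h p ⟨hp, hpT⟩
    obtain ⟨N, hN⟩ := (finite_neighborSet_iff ω ⟨p, hp⟩).1 (h ⟨p, hp⟩)
    have hN' := mem_iInter.1 hpT N
    apply hN'
    rw [mem_setOf_eq, PointConfig.count, Set.encard_eq_zero, Set.eq_empty_iff_forall_notMem]
    rintro q ⟨hq, hqt⟩
    exact absurd (hN q hq hqt.1) (not_le.2 hqt.2)
  · intro h v
    rw [finite_neighborSet_iff]
    by_contra hcon
    push Not at hcon
    refine h v ⟨v.2, mem_iInter.2 fun N => ?_⟩
    intro h0
    rw [mem_setOf_eq, PointConfig.count, Set.encard_eq_zero, Set.eq_empty_iff_forall_notMem] at h0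
    obtain ⟨q, hq, hadj, hlt⟩ := hcon N
    exact h0 q ⟨hq, hadj, hlt⟩

end Measurability

end Literature.Probability.LatticeModels

end
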